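import Summits.AtomisticToContinuum.HydrodynamicLimit.Theses.OneFlightGossipEngine
import Literature.Barriers.AtomisticToContinuum.HighMomentumCutoff

/-!
# Sketch for the crux ideas of planner-cruxidea-stmt-AtomisticToContinuum-17615-1-0 (crux `ClampedTransferDock`,
stmt-AtomisticToContinuum-17615, round 1, ideator 1, 2026-08-17)

§1 Card `superexp-tails-small-tilt-band` — First lemma(s):
  * `SuperExponentialEnergyTails` (SEET): the TRUE-law cubic velocity tail decays faster than every exponential in the
    cut-off level, in L¹ with an `ε`-slack (frame of the route's `EnergyCurrentTails`, stmt-9235); strictly between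
    `EnergyCurrentTails` (rate-free) and the catalogued Nachtergaele–Yau hypothesis
    `Literature.Barriers.AtomisticToContinuum.HighMomentumCutoff σ` (Gaussian);
  * `seet_imp_energyCurrentTails : SuperExponentialEnergyTails → EnergyCurrentTails` (PROVED);
  * `BandCoherenceLDFamily`: the REFERENCE-law window exponential-moment bound, ALONG FAMILIES, of the band-restricted
    coherent suprathermal cubic content at the SMALL tilt `(8 Θ̄ K₁)⁻¹` (typed; conjecture-grade; engine-side).
§2 Card `povzner-cooling-fair-kicks` — First lemma(s):
  * `sq_norm_postCollision`: ‖V + r•σ̂‖² bookkeeping for a hard-sphere collision written in centre-of-mass variables (PROVED);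
  * `postCollision_energy_exchange`: the energy moved by one collision is `(Δv · n̂)(V_cm · n̂)` — here in the form
    `‖V + r σ̂‖² - ‖V - r σ̂‖² = 4 r ⟪V, σ̂⟫` (PROVED);
  * `FairKickFourthMomentContraction`: the Povzner-type statement the card's mechanism starts from (typed).

No `sorry`. Nothing here asserts a Theses decl unconditionally.
-/

noncomputable section

namespace Summit.AtomisticToContinuum.HydrodynamicLimit.Cruxes.ClampedTransferDock.IdeatorOneRound1Rev29

open scoped BigOperators ENNReal Classical RealInnerProductSpace
open MeasureTheory Set Filter
open Literature.MathematicalPhysics.KineticTheory Literature.Analysis.FluidPDE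
open Summit.AtomisticToContinuum.HydrodynamicLimit.Theses.OneFlightGossipEngine

/-! ## §1 A super-exponential rate for the cubic tail dissolves the coherence child -/

/-- **SEET — super-exponential energy (cubic) tails under the TRUE pre-shock law, in L¹, with slack.**
Frame of `EnergyCurrentTails` (stmt-9235): for every horizon `t < T`, EVERY exponential rate `c > 0` is eventually beaten by the
limiting cubic-tail profile: `∃ K₀ ∀ K ≥ K₀ ∀ ε ∃ N₀ ∀ N ≥ N₀ ∀ s ≤ t :  E[(N+1)⁻¹ Σᵢ |vᵢ(s)|³ 1{|vᵢ(s)| > K}] ≤ e^{-cK} + ε`.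
The `+ ε` slack makes the statement insensitive to vanishing-probability outliers (the 14607 witness: one particle of speed
`N^{1/3}` contributes `≤ 1 × P(outlier)` here, not `e^{γ N}`); L¹ currency, not exponential. Nachtergaele–Yau's requirement "the error
term stemming from the high-momentum cutoff [must be] smaller than `e^{-CM}` for any `C > 0`" is exactly this. -/
def SuperExponentialEnergyTails : Prop :=
  ∀ (a₀ θ₀ : T3 → ℝ) (u₀ : T3 → V3), Continuous a₀ → Continuous θ₀ → Continuous u₀ → (∀ x, 0 < a₀ x) →
    (∀ x, 0 < θ₀ x) → ∃ σ₀ : ℝ, 0 < σ₀ ∧ ∀ σ : ℝ, 0 < σ → σ < σ₀ →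
    ∀ (T : ℝ) (ρ θ : ℝ → T3 → ℝ) (u : ℝ → T3 → V3), IsHardSphereEulerSolution σ T ρ u θ →
    ∀ Φ : (N : ℕ) → HardSphereFlow (Torus.geometry (Fin 3)) (hsDiameter σ N) (N + 1),
    TendstoHydroFieldsAt (fun N => localGibbsLaw σ a₀ u₀ θ₀ N (Φ N)) Φ ρ u θ 0 →
    ∀ t ∈ Set.Ico 0 T, ∀ c : ℝ, 0 < c → ∃ K₀ : ℝ, 0 < K₀ ∧ ∀ K : ℝ, K₀ ≤ K → ∀ ε : ℝ, 0 < ε →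
    ∃ N₀ : ℕ, ∀ N : ℕ, N₀ ≤ N → ∀ s ∈ Set.Icc 0 t,
      ∫⁻ z, ENNReal.ofReal (((N : ℝ) + 1)⁻¹ * ∑ i : Fin (N + 1),
          Set.indicator {v : V3 | K < ‖v‖} (fun v => ‖v‖ ^ 3) (((Φ N).flow s z i).2))
        ∂(localGibbsLaw σ a₀ u₀ θ₀ N (Φ N)) ≤ ENNReal.ofReal (Real.exp (-(c * K)) + ε)

/-- An elementary choice: for `ε > 0` there is `K ≥ K₀` with `e^{-K} ≤ ε / 2`. -/
theorem exists_level_exp_le (K₀ ε : ℝ) (hε : 0 < ε) : ∃ K : ℝ, K₀ ≤ K ∧ Real.exp (-K) ≤ ε / 2 := by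
  refine ⟨max K₀ (-Real.log (ε / 2)), le_max_left _ _, ?_⟩
  have hε2 : 0 < ε / 2 := by positivity
  calc Real.exp (-max K₀ (-Real.log (ε / 2)))
      ≤ Real.exp (-(-Real.log (ε / 2))) := Real.exp_le_exp.mpr (neg_le_neg (le_max_right _ _))
    _ = ε / 2 := by rw [neg_neg, Real.exp_log hε2]

/-- **SEET implies the route's crux ECT (stmt-9235)**: take the rate `c = 1`, then a level `K ≥ K₀(1)` with `e^{-K} ≤ ε/2`,
then the slack `ε/2`. So adopting SEET as the dock's true-law tail input makes `EnergyCurrentTails` a corollary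
(the planner should then re-badge 9235 in this route; noted on the card). -/
theorem seet_imp_energyCurrentTails (h : SuperExponentialEnergyTails) : EnergyCurrentTails := by
  intro a₀ θ₀ u₀ ha hθ hu ha0 hθ0
  obtain ⟨σ₀, hσ₀, H⟩ := h a₀ θ₀ u₀ ha hθ hu ha0 hθ0
  refine ⟨σ₀, hσ₀, fun σ hσ hσlt T ρ θ u hE Φ htie t ht ε hε => ?_⟩
  obtain ⟨K₀, -, HK⟩ := H σ hσ hσlt T ρ θ u hE Φ htie t ht 1 one_pos
  obtain ⟨K, hK₀K, hexpK⟩ := exists_level_exp_le K₀ ε hε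
  obtain ⟨N₀, HN⟩ := HK K hK₀K (ε / 2) (by positivity)
  refine ⟨K, N₀, fun N hN s hs => (HN N hN s hs).trans (ENNReal.ofReal_le_ofReal ?_)⟩
  have h1 : Real.exp (-(1 * K)) = Real.exp (-K) := by rw [one_mul]
  rw [h1]
  linarith

/-- **From the catalogued Nachtergaele–Yau hypothesis to SEET (the Gaussian moment dominates every exponential rate)** —
stated as the implication the card claims; its proof is `sup_{r > K} r³ e^{-c′r²} → 0` faster than `e^{-cK}` plus
`|v| ≤ |v|` bookkeeping (the barrier's `expVelocityMoment` uses absolute velocities, as ECT does). Typed only. -/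
def GaussianMomentGivesSEET : Prop :=
  (∀ σ : ℝ, 0 < σ → σ < 1 / 2 → Literature.Barriers.AtomisticToContinuum.HighMomentumCutoff σ) →
    SuperExponentialEnergyTails

/-- **BandCoherenceLDFamily — the REFERENCE-law input that replaces the true-law coherence child (ii).**
Frame of `KineticCurrentsLDAlongFamilies` / `KineticCurrentsWindowLDFamily` (one-parameter families of profiles, packing guard,
thresholds uniform with `s` innermost, window quantifier `∃ τ₀ ∀ τ ≥ τ₀`), objects of the heart's S6′
(`CoherentSuprathermalContentVanishesW`: `W`, `cub`, `cubHi`, `qbar`, a measurable radial weight `R` vanishing below `K⋆²`),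
but: (1) under the REFERENCE `λ^N_s = localGibbsLaw σ (a s) (u₀ s) (θ₀ s) N (Φ N)` and its own flow over `[0, w_N]`;
(2) the cubic content is BAND-restricted, `K⋆ < ‖W‖ ≤ K₁`; (3) EXPONENTIAL currency at the SMALL explicit tilt `(8 Θ̄ K₁)⁻¹`,
`Θ̄` a given bound of the family's temperatures — at which a comoving blob of drift `D ≤ K₁` gains `≤ D²/(8Θ̄)` per member against its
Maxwellian cost `D²/(2 θ_s(x)) ≥ D²/(2Θ̄)`: unprofitable by arithmetic; the only dynamical content left is that LONE band carriers are
deflected within `τ → ∞` free times (coherent fraction `→ 0`, uniformly in `N`). -/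
def BandCoherenceLDFamily : Prop :=
  ∃ η₀ : ℝ, 0 < η₀ ∧ ∀ (t₁ Θbar : ℝ) (a θ₀ : ℝ → T3 → ℝ) (u₀ : ℝ → T3 → V3),
    Continuous (Function.uncurry a) → Continuous (Function.uncurry θ₀) → Continuous (Function.uncurry u₀) →
    (∀ s x, 0 < a s x) → (∀ s x, 0 < θ₀ s x) → (∀ s ∈ Set.Icc 0 t₁, ∀ x, θ₀ s x ≤ Θbar) →
    ∀ σ : ℝ, 0 < σ → (∀ s ∈ Set.Icc 0 t₁, σ ^ 3 * (⨆ x, a s x) ≤ η₀ * ∫ x, a s x) →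
    ∀ Φ : (N : ℕ) → HardSphereFlow (Torus.geometry (Fin 3)) (hsDiameter σ N) (N + 1),
    ∀ Kstar K₁ : ℝ, 0 < Kstar → Kstar ≤ K₁ →
    ∀ R : ℝ → T3 → ℝ → ℝ, Measurable (fun p : ℝ × T3 × ℝ => R p.1 p.2.1 p.2.2) →
    (∀ s x s', s' ≤ Kstar ^ 2 → R s x s' = 0) → (∀ s x s', |R s x s'| ≤ |s'|) →
    ∀ η : ℝ, 0 < η → ∀ ε : ℝ, 0 < ε →
    ∃ τ₀ : ℝ, 0 < τ₀ ∧ ∀ τ : ℝ, τ₀ ≤ τ → ∃ N₀ : ℕ, ∀ N : ℕ, N₀ ≤ N → ∀ s ∈ Set.Icc 0 t₁,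
      (let w : ℝ := τ * ((N : ℝ) + 1) ^ (-(1 / 3 : ℝ))
       let P := localGibbsLaw σ (a s) (u₀ s) (θ₀ s) N (Φ N)
       let W := fun (i : Fin (N + 1)) (r : ℝ) (z : Config (N + 1) (Fin 3) T3) =>
         ((Φ N).flow r z i).2 - u₀ s ((Φ N).flow r z i).1
       let cub := fun (i : Fin (N + 1)) (z : Config (N + 1) (Fin 3) T3) =>
         w⁻¹ * ∫ r in (0 : ℝ)..w, ‖W i r z‖ ^ 3
       let cubBand := fun (i : Fin (N + 1)) (z : Config (N + 1) (Fin 3) T3) =>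
         w⁻¹ * ∫ r in (0 : ℝ)..w, (if Kstar < ‖W i r z‖ ∧ ‖W i r z‖ ≤ K₁ then ‖W i r z‖ ^ 3 else 0)
       let qbar := fun (i : Fin (N + 1)) (z : Config (N + 1) (Fin 3) T3) =>
         w⁻¹ • ∫ r in (0 : ℝ)..w, (R s ((Φ N).flow r z i).1 (‖W i r z‖ ^ 2)) • W i r z
       ∫⁻ z, ENNReal.ofReal (Real.exp ((8 * Θbar * K₁)⁻¹ * ∑ i : Fin (N + 1),
              (if η * cub i z < ‖qbar i z‖ then cubBand i z else 0))) ∂P ≤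
         ENNReal.ofReal (Real.exp (ε * ((N : ℝ) + 1))))

/-- The ARITHMETIC of the small tilt (why blobs cannot profit): on the band `‖W‖ ≤ K₁` the tilted cubic weight is dominated by
one eighth of the Gaussian exponent at the hottest temperature, pointwise. -/
theorem band_tilt_le_gaussian {Θbar K₁ r : ℝ} (hΘ : 0 < Θbar) (hK : 0 < K₁) (_hr0 : 0 ≤ r) (hr : r ≤ K₁) :
    (8 * Θbar * K₁)⁻¹ * r ^ 3 ≤ r ^ 2 / (8 * Θbar) := by
  have h8 : 0 < 8 * Θbar * K₁ := by positivity
  rw [inv_mul_le_iff₀ h8, div_eq_mul_inv]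
  have : r ^ 3 ≤ r ^ 2 * K₁ := by
    calc r ^ 3 = r ^ 2 * r := by ring
      _ ≤ r ^ 2 * K₁ := by gcongr
  calc r ^ 3 ≤ r ^ 2 * K₁ := this
    _ = 8 * Θbar * K₁ * (r ^ 2 * (8 * Θbar)⁻¹) := by field_simp

/-! ## §2 Povzner cooling under fair kicks (card `povzner-cooling-fair-kicks`) -/

/-- Centre-of-mass bookkeeping of one elastic hard-sphere collision: post-collisional velocities are `V ± r σ̂` with
`V` the pair's centre-of-mass velocity, `2r = ‖v − v_*‖`, `σ̂` the outgoing unit direction. [folklore] -/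
theorem sq_norm_postCollision (V σhat : V3) (r : ℝ) (hσ : ‖σhat‖ = 1) :
    ‖V + r • σhat‖ ^ 2 = ‖V‖ ^ 2 + r ^ 2 + 2 * r * inner ℝ V σhat := by
  rw [norm_add_sq_real, norm_smul, Real.norm_eq_abs, hσ, mul_one, sq_abs, real_inner_smul_right]
  ring

/-- **Energy exchanged in one collision = (momentum exchanged) × (centre-of-mass velocity along the kick)**:
`‖V + rσ̂‖² − ‖V − rσ̂‖² = 4 r ⟪V, σ̂⟫`. The Povzner mechanism: averaging `σ̂` over a FAIR kick kills this linear term and the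
quartic cross term `(2r⟪V,σ̂⟫)²` averages to `4r²‖V‖²/3`, whence
`E_σ̂[‖v′‖⁴ + ‖v_*′‖⁴] = (‖v‖² + ‖v_*‖²)²/2 + (2/3)(2r)²‖V‖² ≤ (2/3)(‖v‖² + ‖v_*‖²)²` — a strict contraction of the
pair's quartic content whenever one partner is much slower (`‖v_*‖ ≪ ‖v‖`: factor `2/3`). [folklore] -/
theorem postCollision_energy_exchange (V σhat : V3) (r : ℝ) (hσ : ‖σhat‖ = 1) :
    ‖V + r • σhat‖ ^ 2 - ‖V - r • σhat‖ ^ 2 = 4 * r * inner ℝ V σhat := by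
  have h1 := sq_norm_postCollision V σhat r hσ
  have h2 := sq_norm_postCollision V σhat (-r) hσ
  rw [neg_smul, ← sub_eq_add_neg] at h2
  rw [h1, h2]
  ring

/-- **Typed target of the card's first stub (fair-kick quartic contraction, angular average).** For every centre-of-mass
velocity `V`, half relative speed `r ≥ 0` and every probability law `ν` on `V3` carried by the unit sphere with isotropic
second moments (`∫⟪ω,e⟫² dν = ‖e‖²/3`, the kick law of `GossipStressIdentity` / `KacPairHeatFlux`), the ν-average of the
post-collisional quartic content is `(‖V‖²+r²)²·2 + (8/3) r²‖V‖²`, i.e. at most `(4/3)·` and, for disparate partners, at most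
`(2/3)·` the pre-collisional one. The N-particle use (card): `d/dt E Σᵢ ψ(‖vᵢ‖²) = E Σ_{collisions} Δψ` EXACTLY for hard spheres
(speeds change only at collisions — no transport term), and true-law kick fairness in conditional mean turns `Δψ` into this
average collision by collision. -/
def FairKickFourthMomentIdentity : Prop :=
  ∀ (ν : Measure V3), IsProbabilityMeasure ν → (∀ᵐ ω ∂ν, ‖ω‖ = 1) → (∫ ω, ω ∂ν = 0) →
    (∀ e : V3, ∫ ω, inner ℝ ω e ^ 2 ∂ν = ‖e‖ ^ 2 / 3) →
    ∀ (V : V3) (r : ℝ), 0 ≤ r →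
      ∫ ω, (‖V + r • ω‖ ^ 4 + ‖V - r • ω‖ ^ 4) ∂ν = 2 * (‖V‖ ^ 2 + r ^ 2) ^ 2 + (8 / 3) * r ^ 2 * ‖V‖ ^ 2

end Summit.AtomisticToContinuum.HydrodynamicLimit.Cruxes.ClampedTransferDock.IdeatorOneRound1Rev29

end
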